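import Literature.Geometry.Kaehler.ComplexTorusEquivariantEndomorphismAlgebraCommutantGroupAlgebraCMType
import Literature.Geometry.Kaehler.ComplexTorusEquivariantEndomorphismAlgebraCommutantStableSubtori
import Literature.Geometry.Kaehler.ComplexTorusSimpleIffEndomorphismAlgebra
import HarnessLib

/-!
# One occurring Galois class: `ρ̄(e_W) = 1`, and in the CM case `X` is `G`-simple with `End_ℚ^G(X) ≅ ℚ(χ)` a CM
# field of degree `2 dim X` (Dolgachev–Zarhin Thm. 2.18: "`B` of dimension `(ℓ-1)/2` with `End_ℚ(B) ≅ ℚ(ζ_ℓ)`")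

Layer `Literature/Geometry/Kaehler`, namespace `Literature.Geometry.Kaehler.ComplexTorus`; lane `lit-hodgefound`
(Track 2 foundations library), Layer A2, row «A2-26(eq)» (self-proposed 2026-08-27, prover seat `lit-hodgefound-p10`,
generation 26, FILE 11).  Sequel of g26-#6/#7 (CM by `ℚ[ρ(G)] ≅ Π_{χ ∈ S} ℚ(χ)`) and of g26-#1/#2 (the centre
`Z ≅ Π ℚ(χ_i)`, a field iff ONE Galois class occurs): THIS FILE treats the case of a SINGLE occurring Galois class
`W = 𝒮(χ)` — the building block "`B`" of Dolgachev–Zarhin's Theorem 2.18 (`G = μ_ℓ`, `End_ℚ(B) ≅ ℚ(ζ_ℓ)`,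
`dim B = (ℓ-1)/2`): `ρ̄(e_W) = 1` (so `X^{e_W} = X`), and when moreover every occurring character is linear of
multiplicity one, `rk H₁(X,ℤ) = [ℚ(χ):ℚ]`, the rational representation `H₁(X,ℚ)` is an IRREDUCIBLE `ℚ[G]`-module,
`X` is `G`-SIMPLE, and `End_ℚ^G(X) ≅ ℚ(χ)` is a CM field of degree `2 dim X`.  CONSUMED BY NAME, nothing restated:
g26-#6 `groupAlgebraRep_eq_zero_iff` (the kernel of `ρ̄`), `endAlgRatG_eq_centralizer_of_forall_linear`; g26-#5
`forall_mul_comm_and_finrank_eq_card_iff`; g26-#2 `forall_mul_comm_iff_center_endAlgRatG_eq_top`,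
`IsOccurringTransversal.isField_endAlgRatG_iff_card_eq_one_of_comm`; g26-#1 `centerAlgEquivCharField`; g26-#7
`isCMField_charField_of_forall_linear`; gen-24 `isGSimpleSubtorus_top_iff_isSimpleModule` (equality case: `X`
`G`-simple ⟺ `ρ_r` irreducible); p38 `natCast_finrank_smulFixed_ratCharIdempotent`,
`exists_classInner_moduleChar_eq_schurIndex_mul`, `schurIndex_pos`, `ratCharIdempotent_(eq_of_isGaloisConj|
mul_ratCharIdempotent_of_not_isGaloisConj|ne_zero)`, `card_galoisClass_eq_finrank_charField`; gen-16
`RatRepModule.smul_def`; A1 `idemSubspace_one`.  THEOREMS ONLY (0 definitions, 0 named facts, 0 instances; D-0026,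
net debt 0).

## Sources, VERBATIM (held texts; `p0NNN` = page / chunk file)

* I. Dolgachev, Yu. G. Zarhin, *Endomorphisms of Complex Abelian Varieties* (2024; held
  `paper:galaxy-pdf-8712177384607648460`), §2.2 p0036 Thm. 2.18: "Then, either `End(A)_δ = ℤ[δ]`, or `End_ℚ(A)_δ` is
  isomorphic to the matrix algebra of size `r` over the field `ℚ[δ]`, and `A` is isogenous to a self-product `B^r` of
  a `(ℓ - 1)/2`-dimensional abelian variety `B` with `End_ℚ(B) ≅ ℚ(ζ_ℓ)`."
* H. Lange, R. E. Rodríguez, *Decomposition of Jacobians by Prym Varieties*, LNM 2310 (2022), §2.7 p0038 (a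
  `G`-simple abelian variety: no non-trivial `G`-stable abelian subvarieties; Thm. 2.7.1); §2.9.1 p0045 Thm. 2.9.2
  ("`B_W` is `G`-simple"), p0046 Prop. 2.9.3 (i) "`dim A_j = ½ h_j [L_j:ℚ] dim V_j`".
* G. Shimura, *Abelian Varieties with Complex Multiplication and Modular Functions* (1998), §5.2 p0051 ("the CM-field
  `K` of degree `2n`").
* I. M. Isaacs, *Character Theory of Finite Groups* (1976), Lemma 9.17 (c), Cor. 10.2 (c) — through p38.

## What is proved

* §1 (any `G`-torus) **`groupAlgebraRep_ratCharIdempotent_eq_one_iff`** (`ρ̄(e_ℚ(χ)) = 1` ⟺ every occurring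
  character is Galois conjugate to `χ`), `smul_eq_self_of_groupAlgebraRep_eq_one`,
  `idemSubspace_ratCharIdempotent_eq_top` (`X^{e_W} = X`), `natCast_finrank_eq_of_forall_smul_eq` (a `ℚ[G]`-module on
  which `e_ℚ(χ)` acts as `1` has `ℚ`-dimension `|𝒮(χ)| χ(1) [M ⊗ ℂ, χ]`), `card_galoisClass_le_finrank_of_forall_smul_eq`.
* §2 (CM case, one class) **`natCast_card_eq_card_galoisClass`**, **`finrank_charField_eq_card`**
  (`[ℚ(χ):ℚ] = rk H₁(X,ℤ) = 2 dim X`), **`isSimpleModule_ratRepModule_of_forall_isGaloisConj`** (`H₁(X,ℚ)` irreducible),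
  **`isGSimpleSubtorus_top_of_forall_isGaloisConj`** (`X` is `G`-simple), **`nonempty_endAlgRatG_algEquiv_charField`**
  (`End_ℚ^G(X) ≃ₐ ℚ(χ)`), `isField_endAlgRatG_of_forall_isGaloisConj`, `isCMField_charField_of_forall_isGaloisConj`,
  `IsOccurringTransversal.isField_endAlgRatG_iff_card_eq_one_of_forall_linear`,
  `IsOccurringTransversal.isGSimpleSubtorus_top_of_card_eq_one`.

## References

* [DolgachevZarhin2024] I. Dolgachev, Yu. G. Zarhin, *Endomorphisms of Complex Abelian Varieties* (2024), §2.2 Thm. 2.18.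
* [LangeRodriguez2022] H. Lange, R. E. Rodríguez, *Decomposition of Jacobians by Prym Varieties*, LNM 2310 (2022),
  §2.7 Thm. 2.7.1, §2.9.1 Thm. 2.9.2, Prop. 2.9.3 (i), pp. 38, 45–46 of the held text.
* [Shimura1998] G. Shimura, *Abelian Varieties with Complex Multiplication and Modular Functions* (1998), §5.2.
* [Isaacs1976] I. M. Isaacs, *Character Theory of Finite Groups* (1976), Lemma 9.17 (c), Cor. 10.2 (c).
-/

noncomputable section

open Module Function
open scoped Matrix

namespace Literature.Geometry.Kaehler

namespace ComplexTorus

open Literature.RepresentationTheory.FiniteGroups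

universe u

variable {ι : Type u} [Fintype ι] [DecidableEq ι] {E : Type*} [NormedAddCommGroup E] [NormedSpace ℂ E]
  {Φ : (ι → ℝ) ≃L[ℝ] E} {G : Type} [Group G] [Fintype G] (ρ : G →* endAlgRat Φ)

/-! ### §1 `ρ̄(e_W) = 1`: one occurring Galois class -/

section One

/-- **`ρ̄(e_ℚ(χ)) = 1` iff every character occurring in `H₁(X,ℂ)` is Galois conjugate to `χ`** (one occurring
Galois class; `1 - e_W = Σ_{W' ≠ W} e_{W'}` lies in the kernel of `ρ̄` iff no other class occurs).
[cite: LangeRodriguez2022, §2.9.1 Thm. 2.9.1 and (2.27) ("several of them might be zero"), p0042–p0043]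
[cite: DolgachevZarhin2024, §2.2 Thm. 2.18, p0036] -/
theorem groupAlgebraRep_ratCharIdempotent_eq_one_iff {χ : G → ℂ} (hχ : IsIrrChar G χ) :
    groupAlgebraRep ρ (ratCharIdempotent χ) = 1 ↔
      ∀ ψ : G → ℂ, IsIrrChar G ψ → complexGroupAlgebraRep ρ (charIdempotent ψ) ≠ 0 → IsGaloisConj χ ψ := by
  have h1 : groupAlgebraRep ρ (ratCharIdempotent χ) = 1 ↔ groupAlgebraRep ρ (1 - ratCharIdempotent χ) = 0 := by
    rw [map_sub, map_one, sub_eq_zero, eq_comm]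
  rw [h1, groupAlgebraRep_eq_zero_iff]
  refine forall_congr' fun ψ ↦ forall_congr' fun hψ ↦ forall_congr' fun _ ↦ ?_
  rw [sub_mul, one_mul, sub_eq_zero]
  constructor
  · intro h
    by_contra hne
    rw [ratCharIdempotent_mul_ratCharIdempotent_of_not_isGaloisConj hχ hψ hne] at h
    exact ratCharIdempotent_ne_zero hψ h
  · intro h
    rw [ratCharIdempotent_eq_of_isGaloisConj hχ h, (isIdempotentElem_ratCharIdempotent hψ).eq]

omit [Fintype G] in
/-- If `ρ̄(x) = 1` then `x` acts as the identity on `ρ_r = H₁(X,ℚ)`. [cite: LangeRodriguez2022, §2.9.1 (2.26), p0042] -/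
theorem smul_eq_self_of_groupAlgebraRep_eq_one {x : MonoidAlgebra ℚ G} (hx : groupAlgebraRep ρ x = 1)
    (v : RatRepModule ρ) : x • v = v := by
  apply (RatRepModule.toFun ρ).injective
  rw [RatRepModule.smul_def, hx, Subalgebra.coe_one, Matrix.one_mulVec]

/-- **One occurring class: `X^{e_W} = X`.** [cite: LangeRodriguez2022, §2.9.1 Thm. 2.9.1 (the addition map is an isogeny), p0043]
[cite: DolgachevZarhin2024, §2.2 Thm. 2.18, p0036] -/
theorem idemSubspace_ratCharIdempotent_eq_top {χ : G → ℂ} (hχ : IsIrrChar G χ)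
    (hcov : ∀ ψ : G → ℂ, IsIrrChar G ψ → complexGroupAlgebraRep ρ (charIdempotent ψ) ≠ 0 → IsGaloisConj χ ψ) :
    idemSubspace ((groupAlgebraRep ρ (ratCharIdempotent χ) : endAlgRat Φ) : Matrix ι ι ℚ) = ⊤ := by
  rw [(groupAlgebraRep_ratCharIdempotent_eq_one_iff ρ hχ).2 hcov, Subalgebra.coe_one, idemSubspace_one]

omit [Fintype ι] [DecidableEq ι] [NormedAddCommGroup E] [NormedSpace ℂ E] in
/-- A `ℚ[G]`-module on which `e_ℚ(χ)` acts as the identity has **`dim_ℚ M = |𝒮(χ)|·χ(1)·[M ⊗ ℂ, χ]`** (it is its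
own `W`-isotypic part). [cite: Isaacs1976, Cor. 10.2 (c) and Lemma 9.17 (c), p0159, p0151] [cite: LangeRodriguez2022, §2.8 (2.20), p0039] -/
theorem natCast_finrank_eq_of_forall_smul_eq {M : Type*} [AddCommGroup M] [Module (MonoidAlgebra ℚ G) M]
    [Module ℚ M] [IsScalarTower ℚ (MonoidAlgebra ℚ G) M] [Module.Finite ℚ M] {χ : G → ℂ} (hχ : IsIrrChar G χ)
    (hM : ∀ m : M, ratCharIdempotent χ • m = m) :
    (finrank ℚ M : ℂ) = (galoisClass χ).card * χ 1 * classInner (moduleChar G M) χ := by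
  have htop : Corner.smulFixed ℚ (ratCharIdempotent χ) M = ⊤ :=
    eq_top_iff.2 fun m _ ↦ (Corner.mem_smulFixed_iff ℚ).2 (hM m)
  rw [← natCast_finrank_smulFixed_ratCharIdempotent (M := M) hχ, htop, finrank_top]

omit [Fintype ι] [DecidableEq ι] [NormedAddCommGroup E] [NormedSpace ℂ E] in
/-- … hence a NONZERO such module has `dim_ℚ M ≥ |𝒮(χ)|` (`[M ⊗ ℂ, χ] = s·h` with `h ≥ 1`).
[cite: Isaacs1976, Cor. 10.2 (c), p0159] [cite: LangeRodriguez2022, §2.8 (2.20) (`dim_ℚ W = s |𝒮| dim V`), p0039] -/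
theorem card_galoisClass_le_finrank_of_forall_smul_eq {M : Type*} [AddCommGroup M] [Module (MonoidAlgebra ℚ G) M]
    [Module ℚ M] [IsScalarTower ℚ (MonoidAlgebra ℚ G) M] [Module.Finite ℚ M] [Nontrivial M] {χ : G → ℂ}
    (hχ : IsIrrChar G χ) (hM : ∀ m : M, ratCharIdempotent χ • m = m) :
    (galoisClass χ).card ≤ finrank ℚ M := by
  obtain ⟨h, hh⟩ := exists_classInner_moduleChar_eq_schurIndex_mul (M := M) hχ
  obtain ⟨d, hd0, hd⟩ := hχ.exists_pos_apply_one_eq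
  have hfin := natCast_finrank_eq_of_forall_smul_eq hχ hM
  rw [hh, hd] at hfin
  have hnat : finrank ℚ M = (galoisClass χ).card * d * (schurIndex χ * h) := by exact_mod_cast hfin
  have hpos : 0 < finrank ℚ M := finrank_pos
  have hh0 : 0 < h := by
    rcases Nat.eq_zero_or_pos h with h0 | h0
    · rw [hnat, h0, mul_zero, mul_zero] at hpos; exact absurd hpos (lt_irrefl 0)
    · exact h0
  rw [hnat, mul_assoc]
  exact Nat.le_mul_of_pos_right _ (Nat.mul_pos hd0 (Nat.mul_pos (schurIndex_pos hχ) hh0))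

end One

/-! ### §2 The CM case with one occurring class: Dolgachev–Zarhin's `B` -/

section CM

/-- **One class, CM case: `rk H₁(X,ℤ) = |𝒮(χ)|`** (in `ℂ`). [cite: DolgachevZarhin2024, §2.2 Thm. 2.18 (`dim B = (ℓ-1)/2`), p0036]
[cite: LangeRodriguez2022, §2.9.1 Prop. 2.9.3 (i), p0046] -/
theorem natCast_card_eq_card_galoisClass
    (H : ∀ χ : G → ℂ, IsIrrChar G χ → complexGroupAlgebraRep ρ (charIdempotent χ) ≠ 0 →
      classInner (moduleChar G (RatRepModule ρ)) χ = 1 ∧ χ 1 = 1)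
    {χ : G → ℂ} (hχ : IsIrrChar G χ) (hP : complexGroupAlgebraRep ρ (charIdempotent χ) ≠ 0)
    (hcov : ∀ ψ : G → ℂ, IsIrrChar G ψ → complexGroupAlgebraRep ρ (charIdempotent ψ) ≠ 0 → IsGaloisConj χ ψ) :
    (Fintype.card ι : ℂ) = (galoisClass χ).card := by
  have hfr : finrank ℚ (RatRepModule ρ) = Fintype.card ι := by
    rw [(RatRepModule.toFun ρ).finrank_eq, Module.finrank_fintype_fun_eq_card]
  rw [← hfr, natCast_finrank_eq_of_forall_smul_eq hχ (smul_eq_self_of_groupAlgebraRep_eq_one ρ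
    ((groupAlgebraRep_ratCharIdempotent_eq_one_iff ρ hχ).2 hcov)), (H χ hχ hP).1, (H χ hχ hP).2, mul_one, mul_one]

/-- **One class, CM case: `[ℚ(χ):ℚ] = rk H₁(X,ℤ) = 2 dim X`** ("`End_ℚ(B) ≅ ℚ(ζ_ℓ)`, `dim B = (ℓ-1)/2`"; "the CM-field
`K` of degree `2n`"). [cite: DolgachevZarhin2024, §2.2 Thm. 2.18, p0036] [cite: Shimura1998, §5.2 (CM-type `(K; {φ_i})`, `[K:ℚ] = 2n`), p0051] -/
theorem finrank_charField_eq_card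
    (H : ∀ χ : G → ℂ, IsIrrChar G χ → complexGroupAlgebraRep ρ (charIdempotent χ) ≠ 0 →
      classInner (moduleChar G (RatRepModule ρ)) χ = 1 ∧ χ 1 = 1)
    {χ : G → ℂ} (hχ : IsIrrChar G χ) (hP : complexGroupAlgebraRep ρ (charIdempotent χ) ≠ 0)
    (hcov : ∀ ψ : G → ℂ, IsIrrChar G ψ → complexGroupAlgebraRep ρ (charIdempotent ψ) ≠ 0 → IsGaloisConj χ ψ) :
    finrank ℚ (charField χ) = Fintype.card ι := by
  rw [← card_galoisClass_eq_finrank_charField hχ.isCharacter]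
  exact_mod_cast (natCast_card_eq_card_galoisClass ρ H hχ hP hcov).symm

/-- **One class, CM case: the rational representation `H₁(X,ℚ)` is an IRREDUCIBLE `ℚ[G]`-module** (a nonzero
submodule is a `ℚ[G]`-module on which `e_W` acts as `1`, so has dimension `≥ |𝒮(χ)| = rk H₁(X,ℤ)`).
[cite: LangeRodriguez2022, §2.9.1 Thm. 2.9.2 (`ρ_r` acts on `B_W` "by the representation `W_i`"), p0045]
[cite: DolgachevZarhin2024, §2.2 Thm. 2.18, p0036] -/
theorem isSimpleModule_ratRepModule_of_forall_isGaloisConj [Nonempty ι]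
    (H : ∀ χ : G → ℂ, IsIrrChar G χ → complexGroupAlgebraRep ρ (charIdempotent χ) ≠ 0 →
      classInner (moduleChar G (RatRepModule ρ)) χ = 1 ∧ χ 1 = 1)
    {χ : G → ℂ} (hχ : IsIrrChar G χ) (hP : complexGroupAlgebraRep ρ (charIdempotent χ) ≠ 0)
    (hcov : ∀ ψ : G → ℂ, IsIrrChar G ψ → complexGroupAlgebraRep ρ (charIdempotent ψ) ≠ 0 → IsGaloisConj χ ψ) :
    IsSimpleModule (MonoidAlgebra ℚ G) (RatRepModule ρ) := by
  haveI : Nontrivial (RatRepModule ρ) := (RatRepModule.toFun ρ).toEquiv.nontrivial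
  haveI : Nontrivial (Submodule (MonoidAlgebra ℚ G) (RatRepModule ρ)) :=
    (Submodule.nontrivial_iff (MonoidAlgebra ℚ G)).2 inferInstance
  have he : ∀ v : RatRepModule ρ, ratCharIdempotent χ • v = v :=
    smul_eq_self_of_groupAlgebraRep_eq_one ρ ((groupAlgebraRep_ratCharIdempotent_eq_one_iff ρ hχ).2 hcov)
  have hfr : finrank ℚ (RatRepModule ρ) = Fintype.card ι := by
    rw [(RatRepModule.toFun ρ).finrank_eq, Module.finrank_fintype_fun_eq_card]
  have hcard : Fintype.card ι = (galoisClass χ).card := by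
    exact_mod_cast natCast_card_eq_card_galoisClass ρ H hχ hP hcov
  refine (isSimpleModule_iff _ _).2 ⟨fun N ↦ ?_⟩
  rcases eq_or_ne N ⊥ with hN | hN
  · exact Or.inl hN
  · right
    haveI : Nontrivial N := Submodule.nontrivial_iff_ne_bot.2 hN
    haveI : Module.Finite ℚ N :=
      Module.Finite.of_injective (N.subtype.restrictScalars ℚ) Subtype.coe_injective
    have hle : (galoisClass χ).card ≤ finrank ℚ N :=
      card_galoisClass_le_finrank_of_forall_smul_eq hχ fun m ↦ Subtype.ext (by
        rw [Submodule.coe_smul]; exact he m)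
    have heq : finrank ℚ (N.restrictScalars ℚ) = finrank ℚ (RatRepModule ρ) := by
      refine le_antisymm (Submodule.finrank_le _) ?_
      rw [hfr, hcard]
      exact hle.trans (le_of_eq (LinearEquiv.finrank_eq
        ((Submodule.restrictScalarsEquiv ℚ (MonoidAlgebra ℚ G) (RatRepModule ρ) N).restrictScalars ℚ)).symm)
    exact (Submodule.restrictScalars_eq_top_iff ℚ (MonoidAlgebra ℚ G) (RatRepModule ρ)).1
      (Submodule.eq_top_of_finrank_eq heq)

/-- **ONE CLASS, CM CASE: `X` IS `G`-SIMPLE** — no non-trivial `G`-stable complex sub-tori (the equality case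
`End_ℚ^G(X) = End_{ℚ[G]}(H₁(X,ℚ))` holds, and there `X` is `G`-simple iff `H₁(X,ℚ)` is irreducible, gen-24).
Dolgachev–Zarhin's `B` with `End_ℚ(B) ≅ ℚ(ζ_ℓ)`. [cite: DolgachevZarhin2024, §2.2 Thm. 2.18, p0036]
[cite: LangeRodriguez2022, §2.7 (definition of `G`-simple) and §2.9.1 Thm. 2.9.2, p0038, p0045] -/
theorem isGSimpleSubtorus_top_of_forall_isGaloisConj [Nonempty ι]
    (H : ∀ χ : G → ℂ, IsIrrChar G χ → complexGroupAlgebraRep ρ (charIdempotent χ) ≠ 0 →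
      classInner (moduleChar G (RatRepModule ρ)) χ = 1 ∧ χ 1 = 1)
    {χ : G → ℂ} (hχ : IsIrrChar G χ) (hP : complexGroupAlgebraRep ρ (charIdempotent χ) ≠ 0)
    (hcov : ∀ ψ : G → ℂ, IsIrrChar G ψ → complexGroupAlgebraRep ρ (charIdempotent ψ) ≠ 0 → IsGaloisConj χ ψ) :
    IsGSimpleSubtorus ρ ⊤ :=
  (isGSimpleSubtorus_top_iff_isSimpleModule ρ (endAlgRatG_eq_centralizer_of_forall_linear ρ H)).2
    (isSimpleModule_ratRepModule_of_forall_isGaloisConj ρ H hχ hP hcov)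

/-- **ONE CLASS, CM CASE: `End_ℚ^G(X) ≃ₐ ℚ(χ)`** (`End_ℚ^G(X)` is commutative, so equals its centre `≅ ℚ(χ)`,
g26-#1). "`End_ℚ(B) ≅ ℚ(ζ_ℓ)`". [cite: DolgachevZarhin2024, §2.2 Thm. 2.18, p0036] [cite: Isaacs1976, Thm. 9.21 (proof) and Lemma 9.17 (c), p0153, p0151] -/
theorem nonempty_endAlgRatG_algEquiv_charField
    (H : ∀ χ : G → ℂ, IsIrrChar G χ → complexGroupAlgebraRep ρ (charIdempotent χ) ≠ 0 →
      classInner (moduleChar G (RatRepModule ρ)) χ = 1 ∧ χ 1 = 1)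
    {χ : G → ℂ} (hχ : IsIrrChar G χ) (hP : complexGroupAlgebraRep ρ (charIdempotent χ) ≠ 0)
    (hcov : ∀ ψ : G → ℂ, IsIrrChar G ψ → complexGroupAlgebraRep ρ (charIdempotent ψ) ≠ 0 → IsGaloisConj χ ψ) :
    Nonempty (endAlgRatG Φ ρ ≃ₐ[ℚ] charField χ) := by
  have h := endAlgRatG_eq_centralizer_of_forall_linear ρ H
  have hcomm : ∀ a b : endAlgRatG Φ ρ, a * b = b * a := ((forall_mul_comm_and_finrank_eq_card_iff ρ h).2 H).1
  have e : endAlgRatG Φ ρ ≃ₐ[ℚ] Subalgebra.center ℚ (endAlgRatG Φ ρ) :=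
    Subalgebra.topEquiv.symm.trans (Subalgebra.equivOfEq _ _
      ((forall_mul_comm_iff_center_endAlgRatG_eq_top ρ).1 hcomm).symm)
  exact ⟨e.trans (centerAlgEquivCharField ρ h hχ hP hcov)⟩

/-- **One class, CM case: `End_ℚ^G(X)` is a field.** [cite: DolgachevZarhin2024, §2.2 Thm. 2.18 (`End_ℚ(B) ≅ ℚ(ζ_ℓ)`), p0036] -/
theorem isField_endAlgRatG_of_forall_isGaloisConj
    (H : ∀ χ : G → ℂ, IsIrrChar G χ → complexGroupAlgebraRep ρ (charIdempotent χ) ≠ 0 →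
      classInner (moduleChar G (RatRepModule ρ)) χ = 1 ∧ χ 1 = 1)
    {χ : G → ℂ} (hχ : IsIrrChar G χ) (hP : complexGroupAlgebraRep ρ (charIdempotent χ) ≠ 0)
    (hcov : ∀ ψ : G → ℂ, IsIrrChar G ψ → complexGroupAlgebraRep ρ (charIdempotent ψ) ≠ 0 → IsGaloisConj χ ψ) :
    IsField (endAlgRatG Φ ρ) := by
  obtain ⟨e⟩ := nonempty_endAlgRatG_algEquiv_charField ρ H hχ hP hcov
  exact MulEquiv.isField (Field.toIsField (charField χ)) e.toMulEquiv

/-- **One class, CM case: `End_ℚ^G(X) ≅ ℚ(χ)` is a CM FIELD of degree `2 dim X`** ("the CM-field `K` of degree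
`2n`"; `ℚ(ζ_ℓ)`). [cite: Shimura1998, §5.2 (CM-type) and §5.1 Prop. 5, p0051, p0050] [cite: DolgachevZarhin2024, §2.2 Thm. 2.18, p0036] -/
theorem isCMField_charField_of_forall_isGaloisConj [FiniteDimensional ℂ E]
    (H : ∀ χ : G → ℂ, IsIrrChar G χ → complexGroupAlgebraRep ρ (charIdempotent χ) ≠ 0 →
      classInner (moduleChar G (RatRepModule ρ)) χ = 1 ∧ χ 1 = 1)
    {χ : G → ℂ} (hχ : IsIrrChar G χ) (hP : complexGroupAlgebraRep ρ (charIdempotent χ) ≠ 0)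
    (hcov : ∀ ψ : G → ℂ, IsIrrChar G ψ → complexGroupAlgebraRep ρ (charIdempotent ψ) ≠ 0 → IsGaloisConj χ ψ) :
    NumberField.IsCMField (charField χ) ∧ finrank ℚ (charField χ) = Fintype.card ι ∧
      Nonempty (endAlgRatG Φ ρ ≃ₐ[ℚ] charField χ) :=
  ⟨isCMField_charField_of_forall_linear ρ H hχ hP, finrank_charField_eq_card ρ H hχ hP hcov,
    nonempty_endAlgRatG_algEquiv_charField ρ H hχ hP hcov⟩

/-- Transversal form: **in the CM case `End_ℚ^G(X)` is a field iff exactly ONE Galois class occurs.**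
[cite: DolgachevZarhin2024, §2.2 Thm. 2.18, p0036] [cite: LangeRodriguez2022, §2.9.1 Thm. 2.9.1 (b), p0043] -/
theorem IsOccurringTransversal.isField_endAlgRatG_iff_card_eq_one_of_forall_linear {S : Finset (G → ℂ)}
    (hS : IsOccurringTransversal ρ S)
    (H : ∀ χ : G → ℂ, IsIrrChar G χ → complexGroupAlgebraRep ρ (charIdempotent χ) ≠ 0 →
      classInner (moduleChar G (RatRepModule ρ)) χ = 1 ∧ χ 1 = 1) :
    IsField (endAlgRatG Φ ρ) ↔ S.card = 1 := by
  have h := endAlgRatG_eq_centralizer_of_forall_linear ρ H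
  exact hS.isField_endAlgRatG_iff_card_eq_one_of_comm h ((forall_mul_comm_and_finrank_eq_card_iff ρ h).2 H).1

/-- Transversal form: **in the CM case with ONE occurring class `X` is `G`-simple.**
[cite: DolgachevZarhin2024, §2.2 Thm. 2.18, p0036] [cite: LangeRodriguez2022, §2.9.1 Thm. 2.9.2, p0045] -/
theorem IsOccurringTransversal.isGSimpleSubtorus_top_of_card_eq_one [Nonempty ι] {S : Finset (G → ℂ)}
    (hS : IsOccurringTransversal ρ S)
    (H : ∀ χ : G → ℂ, IsIrrChar G χ → complexGroupAlgebraRep ρ (charIdempotent χ) ≠ 0 →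
      classInner (moduleChar G (RatRepModule ρ)) χ = 1 ∧ χ 1 = 1)
    (h1 : S.card = 1) : IsGSimpleSubtorus ρ ⊤ := by
  obtain ⟨χ, hSχ⟩ := Finset.card_eq_one.1 h1
  have hχS : χ ∈ S := by rw [hSχ]; exact Finset.mem_singleton_self χ
  refine isGSimpleSubtorus_top_of_forall_isGaloisConj ρ H (hS.isIrrChar χ hχS) (hS.ne_zero χ hχS) fun ψ hψ hPψ ↦ ?_
  obtain ⟨χ', hχ', hconj⟩ := hS.exists_mem ψ hψ hPψ
  rw [hSχ, Finset.mem_singleton] at hχ'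
  exact hχ' ▸ hconj

end CM

end ComplexTorus

end Literature.Geometry.Kaehler

end
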